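import Mathlib.Analysis.ODE.ExistUnique
import Mathlib.Analysis.ODE.Gronwall
import Mathlib.Analysis.Calculus.Deriv.MeanValue
import Mathlib.Analysis.SpecialFunctions.Integrals.Basic
import Literature.Probability.RandomPlanarGeometry.LoewnerChainProofs
import Literature.Probability.RandomPlanarGeometry.ConformalMapRiemannProofs
import HarnessLib

/-!
# The chordal Loewner flow: the backward flow and conformality of `gₜ : Hₜ → ℍ`

Trunk T-STOCH. For a continuous driving function `W` we prove that the Loewner map
`gₜ = Literature.Loewner.map W t` is a **conformal equivalence of the Loewner domain `Hₜ = ℍₒ ∖ Kₜ` onto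
the open upper half-plane** — the named fact `Literature.Probability.RandomPlanarGeometry.Loewner.exists_conformalEquiv_map`
(`Literature/Probability/RandomPlanarGeometry/LoewnerChain.lean`; Lawler (2005), Ch. 4 §4.1,
Thm. 4.6) — by constructing its inverse, the **backward Loewner flow**.

* `Literature.Probability.RandomPlanarGeometry.Loewner.map_eq_of_isSolution` — `map W t z = g t` for every solution `g` alive at `t`
  (uniqueness of the flow, `IsSolution.eqOn_holds`).
* The backward flow. For `w ∈ ℍₒ` the time-reversed equation `ḣ = -2/(h - W(t-s))`,
  `h 0 = w`, has a solution on `[0, t]` along which `im h` increases; we solve the equation with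
  the field truncated below the level `im = m` (`Literature.Probability.RandomPlanarGeometry.Loewner.liftIm`, `Literature.Probability.RandomPlanarGeometry.Loewner.bwdField`:
  globally bounded and Lipschitz, so Mathlib's Picard–Lindelöf theorem `IsPicardLindelof` applies
  on the whole time interval) and observe that the truncation is never active
  (`Literature.Probability.RandomPlanarGeometry.Loewner.exists_backward_solution`). Reversing time gives a forward solution started at
  `z = h t` and alive beyond `t` with `gₜ(z) = w`: **`gₜ` maps `Hₜ` onto `ℍₒ`**
  (`Literature.Probability.RandomPlanarGeometry.Loewner.surjOn_map`); it maps into `ℍₒ` (`IsSolution.im_pos`) and is injective by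
  backward uniqueness (`ODE_solution_unique_of_mem_Icc_left`): `Literature.Probability.RandomPlanarGeometry.Loewner.bijOn_map`.
* Holomorphy. For two backward solutions the difference `D = h_w - h_{w₀}` satisfies the *linear*
  equation `Ḋ = A D` with the explicit continuous coefficient
  `A = 2 / ((h_w - W(t-·)) (h_{w₀} - W(t-·)))`, whence `D(t) = (w - w₀) exp ∫₀ᵗ A` and, letting
  `w → w₀`, the inverse map `fₜ = gₜ⁻¹` is holomorphic on `ℍₒ` with
  `fₜ'(w₀) = exp ∫₀ᵗ 2 / (h_{w₀}(s) - W(t-s))² ds ≠ 0` (`Literature.Probability.RandomPlanarGeometry.Loewner.hasDerivAt_invFunOn_map`);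
  by the holomorphic inverse function theorem (`Complex.differentiableOn_invFunOn_image`,
  `Literature.Analysis.Complex.RiemannMapping`) `gₜ` is holomorphic on `Hₜ`
  (`Literature.Probability.RandomPlanarGeometry.Loewner.differentiableOn_map`), and
* `Literature.Loewner.exists_conformalEquiv_map_holds : exists_conformalEquiv_map`.

## References

* G. F. Lawler, *Conformally Invariant Processes in the Plane*, AMS (2005), Ch. 4 §4.1,
  Thm. 4.6 and eq. (4.7) (`∂ₜ log gₜ' = -2/(gₜ - Uₜ)²`).
-/

noncomputable section

open Set Filter Topology Metric Complex
open UpperHalfPlane (upperHalfPlaneSet isOpen_upperHalfPlaneSet)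
open scoped NNReal

namespace Literature.Probability.RandomPlanarGeometry

namespace Loewner

variable {W : ℝ≥0 → ℝ} {z : ℂ} {g : ℝ → ℂ} {T : WithTop ℝ≥0}

/-! ### The Loewner map evaluates solutions -/

/-- For a continuous driving function, `map W t z = g t` for every solution `g` of the Loewner
equation started at `z` and alive at time `t` (the map is defined by choice among solutions,
which agree by `IsSolution.eqOn_holds`). Lawler (2005), Ch. 4 §4.1. [cite: Lawler2005, Ch. 4 §4.1] -/
theorem map_eq_of_isSolution (hW : Continuous W) (h : IsSolution W z g T) {t : ℝ≥0}
    (ht : (t : WithTop ℝ≥0) < T) : map W t z = g t := by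
  classical
  have hex : ∃ p : (ℝ → ℂ) × WithTop ℝ≥0, IsSolution W z p.1 p.2 ∧ (t : WithTop ℝ≥0) < p.2 :=
    ⟨(g, T), h, ht⟩
  rw [map, dif_pos hex]
  have hp := hex.choose_spec
  have hmem : ((t : ℝ≥0) : ℝ) ∈ {s : ℝ | 0 ≤ s ∧ (s.toNNReal : WithTop ℝ≥0) < min hex.choose.2 T} :=
    ⟨t.coe_nonneg, by simpa using ⟨hp.2, ht⟩⟩
  exact IsSolution.eqOn_holds hW hp.1 h hmem

/-- At time `0` the Loewner map is the identity off the driving point (for a continuous driving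
function). [folklore] -/
theorem map_zero_apply (hW : Continuous W) (hz : z ≠ W 0) : map W 0 z = z := by
  obtain ⟨g, hg⟩ := exists_isSolution_swallowingTime_holds hW hz
  have h0 : ((0 : ℝ≥0) : WithTop ℝ≥0) < swallowingTime W z := swallowingTime_pos_holds hW hz
  rw [map_eq_of_isSolution hW hg h0]
  simpa using hg.apply_zero

/-- The imaginary part decreases along a solution of the Loewner equation
(`(im g)˙ = -2 im g / |g - W|² ≤ 0` as long as `im g ≥ 0`, which holds for a continuous
driving function by `IsSolution.im_pos`). Lawler (2005), Ch. 4 §4.1. [cite: Lawler2005, Ch. 4 §4.1] -/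
theorem IsSolution.im_antitoneOn (hW : Continuous W) (h : IsSolution W z g T) (hz : 0 < z.im) :
    AntitoneOn (fun s ↦ (g s).im) {t : ℝ | 0 ≤ t ∧ (t.toNNReal : WithTop ℝ≥0) < T} := by
  set D : Set ℝ := {t : ℝ | 0 ≤ t ∧ (t.toNNReal : WithTop ℝ≥0) < T}
  have hconv : Convex ℝ D := (ordConnected_timeDomain T).convex
  have hy : ∀ s ∈ D, HasDerivWithinAt (fun s ↦ (g s).im)
      (-2 * (g s).im / Complex.normSq (g s - W s.toNNReal)) D s := fun s hs ↦ by
    have h2 : HasDerivWithinAt (fun s ↦ (g s).im) (vectorField W s (g s)).im D s :=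
      Complex.imCLM.hasFDerivAt.comp_hasDerivWithinAt s (h.isIntegralCurveOn s hs)
    rwa [im_vectorField] at h2
  refine antitoneOn_of_hasDerivWithinAt_nonpos hconv (fun s hs ↦ (hy s hs).continuousWithinAt)
    (fun s hs ↦ (hy s (interior_subset hs)).mono interior_subset) fun s hs ↦ ?_
  have hs' := interior_subset hs
  have hpos : 0 < (g s).im := IsSolution.im_pos_holds hW h hz s hs'.1 hs'.2
  have : 0 ≤ Complex.normSq (g s - W s.toNNReal) := Complex.normSq_nonneg _
  have : -2 * (g s).im / Complex.normSq (g s - W s.toNNReal) ≤ 0 :=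
    div_nonpos_of_nonpos_of_nonneg (by linarith) this
  exact this

/-- The Loewner map sends the Loewner domain into the open upper half-plane. Lawler (2005),
Ch. 4 §4.1. [cite: Lawler2005, Ch. 4 §4.1] -/
theorem mapsTo_map (hW : Continuous W) (t : ℝ≥0) :
    MapsTo (map W t) (domain W t) upperHalfPlaneSet := by
  intro z hz
  rw [mem_domain_iff] at hz
  have hz0 : z ≠ W 0 := ne_driving_of_lt_swallowingTime hz.2
  obtain ⟨g, hg⟩ := exists_isSolution_swallowingTime_holds hW hz0
  rw [map_eq_of_isSolution hW hg hz.2]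
  exact IsSolution.im_pos_holds hW hg hz.1 t t.coe_nonneg (by simpa using hz.2)

/-! ### Truncation of the imaginary part and the truncated backward field -/

/-- Lift the imaginary part to at least `m`: `liftIm m x = re x + i max (im x) m`. [folklore] -/
def liftIm (m : ℝ) (x : ℂ) : ℂ := ⟨x.re, max x.im m⟩

/-- Real part of `liftIm`. [folklore] -/
@[simp] theorem liftIm_re (m : ℝ) (x : ℂ) : (liftIm m x).re = x.re := rfl

/-- Imaginary part of `liftIm`. [folklore] -/
@[simp] theorem liftIm_im (m : ℝ) (x : ℂ) : (liftIm m x).im = max x.im m := rfl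

/-- `liftIm m` fixes the points with `im x ≥ m`. [folklore] -/
theorem liftIm_of_le {m : ℝ} {x : ℂ} (h : m ≤ x.im) : liftIm m x = x :=
  Complex.ext rfl (max_eq_left h)

/-- `liftIm m` is `1`-Lipschitz. [folklore] -/
theorem lipschitzWith_liftIm (m : ℝ) : LipschitzWith 1 (liftIm m) := by
  refine LipschitzWith.of_dist_le_mul fun x y ↦ ?_
  rw [NNReal.coe_one, one_mul, Complex.dist_eq, Complex.dist_eq]
  have hre : (liftIm m x - liftIm m y).re = (x - y).re := by simp
  have him : |(liftIm m x - liftIm m y).im| ≤ |(x - y).im| := by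
    simpa using abs_max_sub_max_le_abs x.im y.im m
  rw [Complex.norm_def, Complex.norm_def, Real.sqrt_le_sqrt_iff (Complex.normSq_nonneg _),
    Complex.normSq_apply, Complex.normSq_apply, hre]
  nlinarith [sq_abs (liftIm m x - liftIm m y).im, sq_abs (x - y).im, abs_nonneg (x - y).im,
    abs_nonneg (liftIm m x - liftIm m y).im]

/-- A point with imaginary part at least `m > 0` is at distance `≥ m` from every real point.
[folklore] -/
theorem le_norm_sub_ofReal_of_le_im {m : ℝ} {x : ℂ} (h : m ≤ x.im) (u : ℝ) : m ≤ ‖x - u‖ :=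
  h.trans ((le_abs_self _).trans (by simpa using Complex.abs_im_le_norm (x - u)))

/-- `m ≤ im (liftIm m x)`. [folklore] -/
theorem le_im_liftIm (m : ℝ) (x : ℂ) : m ≤ (liftIm m x).im := le_max_right _ _

/-- The **truncated backward Loewner field** with horizon `t` and truncation level `m`:
`bwdField W t m s x = -2 / (liftIm m x - W (t - s))` (time runs backward from `t`; the driving
value is frozen at `W 0` for `s > t`). Along backward trajectories started at `im w ≥ m` the
truncation is inactive. Lawler (2005), Ch. 4 §4.1 (the inverse flow `fₜ = gₜ⁻¹`). [cite: Lawler2005, Ch. 4 §4.1] -/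
def bwdField (W : ℝ≥0 → ℝ) (t : ℝ≥0) (m : ℝ) (s : ℝ) (x : ℂ) : ℂ :=
  -vectorField W ((t : ℝ) - s) (liftIm m x)

/-- Unfolding lemma for `bwdField`. [folklore] -/
theorem bwdField_apply (W : ℝ≥0 → ℝ) (t : ℝ≥0) (m s : ℝ) (x : ℂ) :
    bwdField W t m s x = -(2 / (liftIm m x - W ((t : ℝ) - s).toNNReal)) := rfl

section Field

variable {m : ℝ≥0} (hm : 0 < m)
include hm

/-- The truncated backward field is bounded by `2/m`. [folklore] -/
theorem norm_bwdField_le (W : ℝ≥0 → ℝ) (t : ℝ≥0) (s : ℝ) (x : ℂ) :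
    ‖bwdField W t m s x‖ ≤ 2 / m := by
  rw [bwdField_apply, norm_neg, norm_div, RCLike.norm_ofNat]
  have h := le_norm_sub_ofReal_of_le_im (le_im_liftIm m x)
    (W ((t : ℝ) - s).toNNReal)
  exact div_le_div_of_nonneg_left (by norm_num) hm h

/-- The truncated backward field is `2/m²`-Lipschitz in space. [folklore] -/
theorem lipschitzWith_bwdField (W : ℝ≥0 → ℝ) (t : ℝ≥0) (s : ℝ) :
    LipschitzWith (2 / m ^ 2) (bwdField W t m s) := by
  have hL := lipschitzOnWith_vectorField W ((t : ℝ) - s) (δ := m) hm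
  have hmaps : MapsTo (liftIm m) univ {w : ℂ | (m : ℝ) ≤ ‖w - W (((t : ℝ) - s).toNNReal)‖} :=
    fun x _ ↦ le_norm_sub_ofReal_of_le_im (le_im_liftIm m x) _
  have h := (hL.comp (lipschitzWith_liftIm m).lipschitzOnWith hmaps).neg
  rw [mul_one] at h
  exact lipschitzOnWith_univ.1 h

/-- The truncated backward field is continuous in time (for a continuous driving function).
[folklore] -/
theorem continuous_bwdField (hW : Continuous W) (t : ℝ≥0) (x : ℂ) :
    Continuous fun s ↦ bwdField W t m s x := by
  have hm' : (0 : ℝ) < m := hm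
  have hden : ∀ s : ℝ, liftIm m x - (W (((t : ℝ) - s).toNNReal) : ℂ) ≠ 0 := fun s ↦
    norm_pos_iff.1 (hm'.trans_le (le_norm_sub_ofReal_of_le_im (le_im_liftIm m x) _))
  simp only [bwdField_apply]
  refine (continuous_const.div ?_ hden).neg
  exact continuous_const.sub
    (Complex.continuous_ofReal.comp (hW.comp (continuous_real_toNNReal.comp
      (continuous_const.sub continuous_id))))

/-- The imaginary part of the truncated backward field is positive. [folklore] -/
theorem im_bwdField_pos (W : ℝ≥0 → ℝ) (t : ℝ≥0) (s : ℝ) (x : ℂ) :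
    0 < (bwdField W t m s x).im := by
  have hm' : (0 : ℝ) < m := hm
  rw [bwdField, Complex.neg_im, im_vectorField, liftIm_im]
  have hpos : (0 : ℝ) < max x.im (m : ℝ) := hm'.trans_le (le_max_right _ _)
  have hns : 0 < Complex.normSq (liftIm m x - W (((t : ℝ) - s).toNNReal)) :=
    Complex.normSq_pos.2 (norm_pos_iff.1
      (hm'.trans_le (le_norm_sub_ofReal_of_le_im (le_im_liftIm m x) _)))
  have : -2 * max x.im (m : ℝ) / Complex.normSq (liftIm m x - W (((t : ℝ) - s).toNNReal)) < 0 :=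
    div_neg_of_neg_of_pos (by linarith) hns
  linarith

/-- **Picard–Lindelöf for the truncated backward field** on the time interval `[-1, t]`
(globally bounded by `2/m` and `2/m²`-Lipschitz, so one cylinder suffices). [folklore] -/
theorem isPicardLindelof_bwdField (hW : Continuous W) (t : ℝ≥0) (w : ℂ) :
    IsPicardLindelof (bwdField W t m) (⟨0, by simp, t.coe_nonneg⟩ : Icc (-1 : ℝ) t) w
      (2 / m * (t + 1)) 0 (2 / m) (2 / m ^ 2) where
  lipschitzOnWith s _ := (lipschitzWith_bwdField hm W t s).lipschitzOnWith
  continuousOn x _ := (continuous_bwdField hm hW t x).continuousOn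
  norm_le s _ x _ := by simpa using norm_bwdField_le hm W t s x
  mul_max_le := by
    have h1 : max ((t : ℝ) - 0) (0 - (-1 : ℝ)) ≤ (t : ℝ) + 1 :=
      max_le (by linarith) (by linarith [t.coe_nonneg])
    have h2 : (0 : ℝ) ≤ 2 / m := by positivity
    have h3 := mul_le_mul_of_nonneg_left h1 h2
    simpa using h3

end Field

/-! ### The backward flow -/

/-- **The backward Loewner flow exists for all times.** For a continuous driving function,
`0 < m` and any `w`, the truncated backward equation `ḣ = bwdField W t m s (h s)` has a solution
on `[-1, t]` with `h 0 = w`, continuous on `ℝ`. [cite: Lawler2005, Ch. 4 §4.1] -/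
theorem exists_backward_solution_trunc (hW : Continuous W) (t : ℝ≥0) {m : ℝ≥0} (hm : 0 < m)
    (w : ℂ) : ∃ h : ℝ → ℂ, h 0 = w ∧ Continuous h ∧
      ∀ s ∈ Icc (-1 : ℝ) t, HasDerivWithinAt h (bwdField W t m s (h s)) (Icc (-1 : ℝ) t) s := by
  obtain ⟨α, hα0, hα⟩ :=
    (isPicardLindelof_bwdField hm hW t w).exists_eq_forall_mem_Icc_hasDerivWithinAt₀
  -- replace `α` by its continuous saturation outside `[-1, t]`
  have hle : (-1 : ℝ) ≤ t := by linarith [t.coe_nonneg]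
  have h0mem : (0 : ℝ) ∈ Icc (-1 : ℝ) t := ⟨by norm_num, t.coe_nonneg⟩
  have hc : ContinuousOn α (Icc (-1 : ℝ) t) := fun s hs ↦ (hα s hs).continuousWithinAt
  refine ⟨IccExtend hle (α ∘ Subtype.val), ?_, ?_, ?_⟩
  · rw [IccExtend_of_mem hle _ h0mem]
    exact hα0
  · exact (continuousOn_iff_continuous_restrict.1 hc).Icc_extend'
  · intro s hs
    have heq : EqOn (IccExtend hle (α ∘ Subtype.val)) α (Icc (-1 : ℝ) t) := fun u hu ↦ by
      rw [IccExtend_of_mem hle _ hu]; rfl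
    exact ((hα s hs).congr_of_mem heq hs).congr_deriv (by rw [heq hs])


/-! ### Injectivity of the Loewner map (backward uniqueness) -/

/-- A solution has an honest derivative at every positive time of its (open-ended) time domain.
[folklore] -/
theorem IsSolution.hasDerivAt (h : IsSolution W z g T) {u : ℝ} (hu0 : 0 < u)
    (huT : (u.toNNReal : WithTop ℝ≥0) < T) : HasDerivAt g (vectorField W u (g u)) u := by
  have h1 : {s : ℝ | 0 ≤ s} ∈ 𝓝 u := mem_of_superset (Ioi_mem_nhds hu0) fun s hs ↦ mem_setOf.2 (le_of_lt hs)
  have hmem : {s : ℝ | 0 ≤ s ∧ (s.toNNReal : WithTop ℝ≥0) < T} ∈ 𝓝 u :=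
    Filter.inter_mem h1 (setOf_toNNReal_lt_mem_nhds huT)
  exact (h.isIntegralCurveOn u ⟨hu0.le, huT⟩).hasDerivAt hmem

/-- **The Loewner map is injective on the Loewner domain** (for a continuous driving function):
two solutions with the same value at time `t` agree on `[0, t]` by uniqueness for the
time-reversed equation (Mathlib `ODE_solution_unique_of_mem_Icc_left`; on `[0, t]` both stay a
positive distance away from the driving function, where the field is Lipschitz).
Lawler (2005), Ch. 4 §4.1. [cite: Lawler2005, Ch. 4 §4.1] -/
theorem injOn_map (hW : Continuous W) (t : ℝ≥0) : InjOn (map W t) (domain W t) := by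
  intro z₁ hz₁ z₂ hz₂ heq
  rw [mem_domain_iff] at hz₁ hz₂
  obtain ⟨G₁, hG₁⟩ := exists_isSolution_swallowingTime_holds hW (ne_driving_of_lt_swallowingTime hz₁.2)
  obtain ⟨G₂, hG₂⟩ := exists_isSolution_swallowingTime_holds hW (ne_driving_of_lt_swallowingTime hz₂.2)
  rw [map_eq_of_isSolution hW hG₁ hz₁.2, map_eq_of_isSolution hW hG₂ hz₂.2] at heq
  have ht₁ : (((t : ℝ)).toNNReal : WithTop ℝ≥0) < swallowingTime W z₁ := by simpa using hz₁.2
  have ht₂ : (((t : ℝ)).toNNReal : WithTop ℝ≥0) < swallowingTime W z₂ := by simpa using hz₂.2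
  obtain ⟨δ₁, hδ₁, hfar₁⟩ := hG₁.exists_le_norm_sub hW t.coe_nonneg ht₁
  obtain ⟨δ₂, hδ₂, hfar₂⟩ := hG₂.exists_le_norm_sub hW t.coe_nonneg ht₂
  set δ : ℝ≥0 := min δ₁ δ₂ with hδ
  have hδpos : 0 < δ := lt_min hδ₁ hδ₂
  have hsub₁ := Icc_subset_timeDomain (T := swallowingTime W z₁) ht₁
  have hsub₂ := Icc_subset_timeDomain (T := swallowingTime W z₂) ht₂
  have key := ODE_solution_unique_of_mem_Icc_left (v := vectorField W)
    (s := fun u ↦ {x : ℂ | (δ : ℝ) ≤ ‖x - W u.toNNReal‖}) (K := 2 / δ ^ 2) (f := G₁) (g := G₂)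
    (a := 0) (b := t) (fun u _ ↦ lipschitzOnWith_vectorField W u hδpos)
    (hG₁.continuousOn.mono hsub₁)
    (fun u hu ↦ (hG₁.hasDerivAt hu.1 (hsub₁ ⟨hu.1.le, hu.2⟩).2).hasDerivWithinAt)
    (fun u hu ↦ (min_le_left _ _ : (δ : ℝ) ≤ δ₁).trans (hfar₁ u ⟨hu.1.le, hu.2⟩))
    (hG₂.continuousOn.mono hsub₂)
    (fun u hu ↦ (hG₂.hasDerivAt hu.1 (hsub₂ ⟨hu.1.le, hu.2⟩).2).hasDerivWithinAt)
    (fun u hu ↦ (min_le_right _ _ : (δ : ℝ) ≤ δ₂).trans (hfar₂ u ⟨hu.1.le, hu.2⟩)) heq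
  have h0 := key ⟨le_rfl, t.coe_nonneg⟩
  rwa [hG₁.apply_zero, hG₂.apply_zero] at h0

/-! ### The backward flow solves the time-reversed Loewner equation -/

section Backward

variable {t : ℝ≥0} {m : ℝ≥0} {h : ℝ → ℂ}

/-- Along a solution of the truncated backward equation the imaginary part increases. [folklore] -/
theorem monotoneOn_im_of_bwd (hm : 0 < m)
    (hd : ∀ s ∈ Icc (-1 : ℝ) t, HasDerivWithinAt h (bwdField W t m s (h s)) (Icc (-1 : ℝ) t) s) :
    MonotoneOn (fun s ↦ (h s).im) (Icc (-1 : ℝ) t) := by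
  have hy : ∀ s ∈ Icc (-1 : ℝ) t, HasDerivWithinAt (fun s ↦ (h s).im)
      (bwdField W t m s (h s)).im (Icc (-1 : ℝ) t) s := fun s hs ↦
    Complex.imCLM.hasFDerivAt.comp_hasDerivWithinAt s (hd s hs)
  refine monotoneOn_of_hasDerivWithinAt_nonneg (convex_Icc _ _)
    (fun s hs ↦ (hy s hs).continuousWithinAt)
    (fun s hs' ↦ (hy s (interior_subset hs')).mono interior_subset) fun s _ ↦ ?_
  exact (im_bwdField_pos hm W t s (h s)).le

/-- Where the imaginary part is at least the truncation level, a solution of the truncated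
backward equation solves the true time-reversed Loewner equation `ḣ = -2/(h - W(t-s))`.
[folklore] -/
theorem hasDerivWithinAt_of_bwd {s : ℝ}
    (hd : HasDerivWithinAt h (bwdField W t m s (h s)) (Icc (-1 : ℝ) t) s)
    (hle : (m : ℝ) ≤ (h s).im) :
    HasDerivWithinAt h (-vectorField W ((t : ℝ) - s) (h s)) (Icc (-1 : ℝ) t) s := by
  have : bwdField W t m s (h s) = -vectorField W ((t : ℝ) - s) (h s) := by
    rw [bwdField, liftIm_of_le hle]
  rwa [this] at hd

/-- **Time reversal.** If `h` solves the time-reversed Loewner equation on `[-ε, t]` (`0 ≤ ε ≤ 1`)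
and stays off the real line there, then `u ↦ h (t - u)` is a solution of the Loewner equation
started at `h t` with lifetime `t + ε`. [folklore] -/
theorem isSolution_reverse {ε : ℝ} (hε0 : 0 ≤ ε) (hε1 : ε ≤ 1)
    (hd : ∀ s ∈ Icc (-ε) (t : ℝ),
      HasDerivWithinAt h (-vectorField W ((t : ℝ) - s) (h s)) (Icc (-1 : ℝ) t) s)
    (him : ∀ s ∈ Icc (-ε) (t : ℝ), 0 < (h s).im) :
    IsSolution W (h t) (fun u ↦ h ((t : ℝ) - u)) ((((t : ℝ) + ε).toNNReal : ℝ≥0) : WithTop ℝ≥0) := by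
  have htε : 0 ≤ (t : ℝ) + ε := by positivity
  refine ⟨by simp, fun u hu ↦ ?_, fun u hu0 huT ↦ ?_⟩
  · -- the derivative of the reversed path
    have hu' : 0 ≤ u ∧ u < (t : ℝ) + ε := by
      refine ⟨hu.1, ?_⟩
      have := WithTop.coe_lt_coe.1 hu.2
      exact (Real.toNNReal_lt_toNNReal_iff_of_nonneg hu.1).1 this
    have hsmem : (t : ℝ) - u ∈ Icc (-ε) (t : ℝ) := ⟨by linarith, by linarith⟩
    have hsmem' : (t : ℝ) - u ∈ Icc (-1 : ℝ) t := ⟨by linarith, by linarith⟩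
    have h1 := hd _ hsmem
    have h2 : HasDerivWithinAt (fun u : ℝ ↦ (t : ℝ) - u) (-1 : ℝ)
        {u : ℝ | 0 ≤ u ∧ (u.toNNReal : WithTop ℝ≥0) < (((t : ℝ) + ε).toNNReal : ℝ≥0)} u := by
      simpa using ((hasDerivAt_id u).const_sub (t : ℝ)).hasDerivWithinAt
    have hmaps : MapsTo (fun u : ℝ ↦ (t : ℝ) - u)
        {u : ℝ | 0 ≤ u ∧ (u.toNNReal : WithTop ℝ≥0) < (((t : ℝ) + ε).toNNReal : ℝ≥0)}
        (Icc (-1 : ℝ) t) := by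
      intro v hv
      have hv' : v < (t : ℝ) + ε := by
        have := WithTop.coe_lt_coe.1 hv.2
        exact (Real.toNNReal_lt_toNNReal_iff_of_nonneg hv.1).1 this
      exact ⟨by linarith, by linarith [hv.1]⟩
    have h3 := h1.scomp u h2 hmaps
    have heq : ((-1 : ℝ) • -vectorField W ((t : ℝ) - ((t : ℝ) - u)) (h ((t : ℝ) - u))) =
        vectorField W u (h ((t : ℝ) - u)) := by
      rw [sub_sub_cancel, neg_one_smul, neg_neg]
    rw [heq] at h3
    exact h3
  · have hu' : u < (t : ℝ) + ε := by
      have := WithTop.coe_lt_coe.1 huT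
      exact (Real.toNNReal_lt_toNNReal_iff_of_nonneg hu0).1 this
    have hpos := him ((t : ℝ) - u) ⟨by linarith, by linarith⟩
    intro hEq
    change h ((t : ℝ) - u) = _ at hEq
    rw [hEq, Complex.ofReal_im] at hpos
    exact lt_irrefl _ hpos

end Backward

/-- **The backward Loewner flow.** For a continuous driving function, a horizon `t`, a level
`0 < m` and a starting point `w` with `im w > m`, there is a solution `h` of the time-reversed
Loewner equation `ḣ(s) = -2/(h(s) - W(t - s))` on `[0, t]` with `h 0 = w`, continuous on `ℝ`,
along which `im h ≥ im w`; its endpoint `z = h t` lies in the Loewner domain `Hₜ` and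
`gₜ(z) = w`. (It is obtained from the truncated equation, whose truncation is inactive along the
trajectory; reversing time on a slightly longer interval `[-ε, t]` yields a forward solution
alive beyond `t`.) Lawler (2005), Ch. 4 §4.1 (`fₜ = gₜ⁻¹` via the backward flow). [cite: Lawler2005, Ch. 4 §4.1] -/
theorem exists_backward_solution (hW : Continuous W) (t : ℝ≥0) {m : ℝ≥0} (hm : 0 < m) {w : ℂ}
    (hw : (m : ℝ) < w.im) :
    ∃ h : ℝ → ℂ, h 0 = w ∧ Continuous h ∧
      (∀ s ∈ Icc (0 : ℝ) t, HasDerivWithinAt h (-vectorField W ((t : ℝ) - s) (h s))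
        (Icc (-1 : ℝ) t) s) ∧
      (∀ s ∈ Icc (0 : ℝ) t, w.im ≤ (h s).im) ∧
      h t ∈ domain W t ∧ map W t (h t) = w := by
  obtain ⟨h, h0, hc, hd⟩ := exists_backward_solution_trunc hW t hm w
  have hmono := monotoneOn_im_of_bwd hm hd
  have h0mem : (0 : ℝ) ∈ Icc (-1 : ℝ) t := ⟨by norm_num, t.coe_nonneg⟩
  have him0 : ∀ s ∈ Icc (0 : ℝ) t, w.im ≤ (h s).im := fun s hs ↦ by
    have := hmono h0mem ⟨by linarith [hs.1], hs.2⟩ hs.1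
    simpa [h0] using this
  -- a little room below `s = 0` where `im h > m` still holds
  obtain ⟨ε, hε0, hε1, hεim⟩ : ∃ ε : ℝ, 0 < ε ∧ ε ≤ 1 ∧ ∀ s ∈ Icc (-ε) (0 : ℝ), (m : ℝ) < (h s).im := by
    have hcont : ContinuousAt (fun s ↦ (h s).im) 0 := (Complex.continuous_im.comp hc).continuousAt
    have hev : ∀ᶠ s in 𝓝 (0 : ℝ), (m : ℝ) < (h s).im :=
      hcont.eventually (lt_mem_nhds (by simpa [h0] using hw))
    obtain ⟨ε, hε, hball⟩ := Metric.eventually_nhds_iff.1 hev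
    refine ⟨min (ε / 2) 1, by positivity, min_le_right _ _, fun s hs ↦ hball ?_⟩
    rw [Real.dist_eq, sub_zero, abs_lt]
    constructor <;> linarith [hs.1, hs.2, min_le_left (ε / 2) 1]
  have himε : ∀ s ∈ Icc (-ε) (t : ℝ), (m : ℝ) < (h s).im := fun s hs ↦ by
    rcases le_or_gt 0 s with h0s | h0s
    · exact hw.trans_le (him0 s ⟨h0s, hs.2⟩)
    · exact hεim s ⟨hs.1, h0s.le⟩
  have hdε : ∀ s ∈ Icc (-ε) (t : ℝ),
      HasDerivWithinAt h (-vectorField W ((t : ℝ) - s) (h s)) (Icc (-1 : ℝ) t) s := fun s hs ↦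
    have hs' : s ∈ Icc (-1 : ℝ) t := ⟨by linarith [hs.1], hs.2⟩
    hasDerivWithinAt_of_bwd (hd s hs') (himε s hs).le
  have hm' : (0 : ℝ) < m := hm
  have hsol := isSolution_reverse hε0.le hε1 hdε fun s hs ↦ hm'.trans (himε s hs)
  have hlt : (t : WithTop ℝ≥0) < ((((t : ℝ) + ε).toNNReal : ℝ≥0) : WithTop ℝ≥0) := by
    rw [WithTop.coe_lt_coe, ← NNReal.coe_lt_coe, Real.coe_toNNReal _ (by positivity)]
    linarith
  have hmap : map W t (h t) = w := by
    rw [map_eq_of_isSolution hW hsol hlt]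
    simp [h0]
  refine ⟨h, h0, hc, fun s hs ↦ hdε s ⟨by linarith [hs.1], hs.2⟩, him0, ?_, hmap⟩
  rw [mem_domain_iff]
  refine ⟨?_, hlt.trans_le hsol.le_swallowingTime⟩
  change 0 < (h t).im
  exact hm'.trans (himε t ⟨by linarith [t.coe_nonneg], le_rfl⟩)

/-- **The Loewner map is onto the upper half-plane.** Lawler (2005), Ch. 4 §4.1, Thm. 4.6.
[cite: Lawler2005, Ch. 4 §4.1] -/
theorem surjOn_map (hW : Continuous W) (t : ℝ≥0) : SurjOn (map W t) (domain W t) upperHalfPlaneSet := by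
  intro w hw
  have hw' : 0 < w.im := hw
  set m : ℝ≥0 := ⟨w.im / 2, by positivity⟩
  have hm : 0 < m := by
    change (0 : ℝ) < w.im / 2
    positivity
  have hmw : (m : ℝ) < w.im := by
    change w.im / 2 < w.im
    linarith
  obtain ⟨h, -, -, -, -, hdom, hmap⟩ := exists_backward_solution hW t hm hmw
  exact ⟨h t, hdom, hmap⟩

/-- **`gₜ : Hₜ → ℍₒ` is a bijection** (continuous driving function). Lawler (2005), Ch. 4
§4.1, Thm. 4.6. [cite: Lawler2005, Ch. 4 §4.1] -/
theorem bijOn_map (hW : Continuous W) (t : ℝ≥0) : BijOn (map W t) (domain W t) upperHalfPlaneSet :=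
  ⟨mapsTo_map hW t, injOn_map hW t, surjOn_map hW t⟩


/-! ### Holomorphy of the backward flow: the linear equation for differences -/

section Linear

variable {t : ℝ≥0} {m : ℝ≥0}

/-- The coefficient of the linear equation satisfied by the difference of two backward
solutions `h, h₀`: `A(u) = 2 / ((h u - W(t-u)) (h₀ u - W(t-u)))` (with imaginary parts lifted
to `≥ m`, inactive along the trajectories, to make `A` globally continuous and bounded).
Lawler (2005), Ch. 4 §4.1, cf. eq. (4.7). [cite: Lawler2005, Ch. 4 §4.1] -/
def bwdCoeff (W : ℝ≥0 → ℝ) (t : ℝ≥0) (m : ℝ≥0) (h h₀ : ℝ → ℂ) (u : ℝ) : ℂ :=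
  2 / ((liftIm m (h u) - W (((t : ℝ) - u).toNNReal)) * (liftIm m (h₀ u) - W (((t : ℝ) - u).toNNReal)))

/-- The coefficient `A` is continuous. [folklore] -/
theorem continuous_bwdCoeff (hW : Continuous W) (hm : 0 < m) {h h₀ : ℝ → ℂ} (hc : Continuous h)
    (hc₀ : Continuous h₀) : Continuous (bwdCoeff W t m h h₀) := by
  have hm' : (0 : ℝ) < m := hm
  have hU : Continuous fun u : ℝ ↦ (W (((t : ℝ) - u).toNNReal) : ℂ) :=
    Complex.continuous_ofReal.comp (hW.comp (continuous_real_toNNReal.comp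
      (continuous_const.sub continuous_id)))
  have hl : Continuous (liftIm (m : ℝ)) := (lipschitzWith_liftIm (m : ℝ)).continuous
  refine continuous_const.div (((hl.comp hc).sub hU).mul ((hl.comp hc₀).sub hU)) fun u ↦ ?_
  refine mul_ne_zero ?_ ?_ <;> refine norm_pos_iff.1 (hm'.trans_le ?_) <;>
    exact le_norm_sub_ofReal_of_le_im (le_im_liftIm _ _) _

/-- The coefficient `A` is bounded by `2/m²`. [folklore] -/
theorem norm_bwdCoeff_le (hm : 0 < m) (h h₀ : ℝ → ℂ) (u : ℝ) :
    ‖bwdCoeff W t m h h₀ u‖ ≤ 2 / m ^ 2 := by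
  have hm' : (0 : ℝ) < m := hm
  rw [bwdCoeff, norm_div, RCLike.norm_ofNat, norm_mul]
  have ha := le_norm_sub_ofReal_of_le_im (le_im_liftIm (m : ℝ) (h u)) (W (((t : ℝ) - u).toNNReal))
  have hb := le_norm_sub_ofReal_of_le_im (le_im_liftIm (m : ℝ) (h₀ u)) (W (((t : ℝ) - u).toNNReal))
  have hprod : (m : ℝ) ^ 2 ≤ ‖liftIm m (h u) - (W (((t : ℝ) - u).toNNReal) : ℂ)‖ *
      ‖liftIm m (h₀ u) - (W (((t : ℝ) - u).toNNReal) : ℂ)‖ := by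
    rw [sq]; exact mul_le_mul ha hb hm'.le (norm_nonneg _)
  exact div_le_div_of_nonneg_left (by norm_num) (by positivity) hprod

/-- `|A_{h,h₀}(u) - A_{h₀,h₀}(u)| ≤ (2/m³) |h u - h₀ u|`. [folklore] -/
theorem norm_bwdCoeff_sub_le (hm : 0 < m) (h h₀ : ℝ → ℂ) (u : ℝ) :
    ‖bwdCoeff W t m h h₀ u - bwdCoeff W t m h₀ h₀ u‖ ≤ 2 / m ^ 3 * ‖h u - h₀ u‖ := by
  have hm' : (0 : ℝ) < m := hm
  set U : ℂ := (W (((t : ℝ) - u).toNNReal) : ℂ)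
  set a : ℂ := liftIm m (h u) - U
  set b : ℂ := liftIm m (h₀ u) - U
  have ha : (m : ℝ) ≤ ‖a‖ := le_norm_sub_ofReal_of_le_im (le_im_liftIm (m : ℝ) (h u)) _
  have hb : (m : ℝ) ≤ ‖b‖ := le_norm_sub_ofReal_of_le_im (le_im_liftIm (m : ℝ) (h₀ u)) _
  have ha0 : a ≠ 0 := norm_pos_iff.1 (hm'.trans_le ha)
  have hb0 : b ≠ 0 := norm_pos_iff.1 (hm'.trans_le hb)
  have hab : ‖b - a‖ ≤ ‖h u - h₀ u‖ := by
    have : b - a = liftIm m (h₀ u) - liftIm m (h u) := by simp [a, b]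
    rw [this, ← dist_eq_norm, dist_comm, ← dist_eq_norm]
    simpa using (lipschitzWith_liftIm (m : ℝ)).dist_le_mul (h u) (h₀ u)
  have h1 : bwdCoeff W t m h h₀ u = 2 / (a * b) := rfl
  have h2 : bwdCoeff W t m h₀ h₀ u = 2 / (b * b) := rfl
  have hid : bwdCoeff W t m h h₀ u - bwdCoeff W t m h₀ h₀ u = 2 * (b - a) / (a * b * b) := by
    rw [h1, h2]
    field_simp
  rw [hid, norm_div, norm_mul, RCLike.norm_ofNat, norm_mul, norm_mul]
  have hden : (m : ℝ) ^ 3 ≤ ‖a‖ * ‖b‖ * ‖b‖ := by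
    have := mul_le_mul (mul_le_mul ha hb hm'.le (norm_nonneg _)) hb hm'.le (by positivity)
    nlinarith [this]
  rw [div_le_iff₀ (by positivity)]
  calc 2 * ‖b - a‖ ≤ 2 * ‖h u - h₀ u‖ := by linarith
    _ = 2 / (m : ℝ) ^ 3 * ‖h u - h₀ u‖ * (m : ℝ) ^ 3 := by field_simp
    _ ≤ 2 / (m : ℝ) ^ 3 * ‖h u - h₀ u‖ * (‖a‖ * ‖b‖ * ‖b‖) := by gcongr

/-- **The linear equation for differences of backward solutions, solved.** If `h, h₀` solve the
time-reversed Loewner equation on `[0, t]` with `im ≥ m` there, then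
`h s - h₀ s = (h 0 - h₀ 0) · exp ∫₀ˢ A_{h,h₀}` for `s ∈ [0, t]`. [cite: Lawler2005, Ch. 4 §4.1] -/
theorem sub_eq_mul_exp_integral (hW : Continuous W) (hm : 0 < m) {h h₀ : ℝ → ℂ}
    (hc : Continuous h) (hc₀ : Continuous h₀)
    (hd : ∀ s ∈ Icc (0 : ℝ) t, HasDerivWithinAt h (-vectorField W ((t : ℝ) - s) (h s))
      (Icc (-1 : ℝ) t) s)
    (hd₀ : ∀ s ∈ Icc (0 : ℝ) t, HasDerivWithinAt h₀ (-vectorField W ((t : ℝ) - s) (h₀ s))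
      (Icc (-1 : ℝ) t) s)
    (him : ∀ s ∈ Icc (0 : ℝ) t, (m : ℝ) ≤ (h s).im) (him₀ : ∀ s ∈ Icc (0 : ℝ) t, (m : ℝ) ≤ (h₀ s).im)
    {s : ℝ} (hs : s ∈ Icc (0 : ℝ) t) :
    h s - h₀ s = (h 0 - h₀ 0) * exp (∫ u in (0 : ℝ)..s, bwdCoeff W t m h h₀ u) := by
  have hm' : (0 : ℝ) < m := hm
  set A := bwdCoeff W t m h h₀ with hA
  have hAc : Continuous A := continuous_bwdCoeff hW hm hc hc₀
  set P : ℝ → ℂ := fun s ↦ ∫ u in (0 : ℝ)..s, A u with hP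
  have hPd : ∀ s, HasDerivAt P (A s) s := fun s ↦ (hAc.integral_hasStrictDerivAt 0 s).hasDerivAt
  set D : ℝ → ℂ := fun s ↦ h s - h₀ s with hD
  -- the linear equation `D' = A D` on `[0, t]`
  have hDd : ∀ s ∈ Icc (0 : ℝ) t, HasDerivWithinAt D (A s * D s) (Icc (-1 : ℝ) t) s := by
    intro s hs
    have h1 := (hd s hs).sub (hd₀ s hs)
    have hU : ∀ x : ℂ, (m : ℝ) ≤ x.im → x - (W (((t : ℝ) - s).toNNReal) : ℂ) ≠ 0 := fun x hx ↦
      norm_pos_iff.1 (hm'.trans_le (le_norm_sub_ofReal_of_le_im hx _))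
    have heq : -vectorField W ((t : ℝ) - s) (h s) - -vectorField W ((t : ℝ) - s) (h₀ s) =
        A s * D s := by
      simp only [vectorField_apply, hA, bwdCoeff, hD, liftIm_of_le (him s hs),
        liftIm_of_le (him₀ s hs)]
      field_simp [hU _ (him s hs), hU _ (him₀ s hs)]
      ring
    rw [heq] at h1
    exact h1
  -- `E = D exp(-P)` is constant
  set E : ℝ → ℂ := fun s ↦ D s * exp (-P s) with hE
  have hEc : ContinuousOn E (Icc (0 : ℝ) t) :=
    ((hc.sub hc₀).mul (continuous_exp.comp (continuous_neg.comp
      (continuous_iff_continuousAt.2 fun s ↦ (hPd s).continuousAt)))).continuousOn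
  have hEd : ∀ s ∈ Ico (0 : ℝ) t, HasDerivWithinAt E 0 (Ici s) s := by
    intro s hs
    have h1 : HasDerivWithinAt D (A s * D s) (Ici s) s := by
      refine ((hDd s ⟨hs.1, hs.2.le⟩).mono (Icc_subset_Icc_left (by linarith [hs.1]) :
        Icc s (t : ℝ) ⊆ Icc (-1 : ℝ) t)).mono_of_mem_nhdsWithin (Icc_mem_nhdsGE hs.2)
    have h2 : HasDerivWithinAt (fun s ↦ exp (-P s)) (exp (-P s) * -A s) (Ici s) s :=
      ((hPd s).neg.cexp).hasDerivWithinAt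
    have h3 := h1.mul h2
    have : A s * D s * exp (-P s) + D s * (exp (-P s) * -A s) = 0 := by ring
    rwa [this] at h3
  have hconst := constant_of_has_deriv_right_zero hEc hEd s hs
  simp only [hE, hP, intervalIntegral.integral_same, neg_zero, exp_zero, mul_one] at hconst
  -- solve for `D s`
  have : D s = D 0 * exp (P s) := by
    have h1 : D s * exp (-P s) * exp (P s) = D 0 * exp (P s) := by rw [hconst]
    rwa [mul_assoc, ← Complex.exp_add, neg_add_cancel, exp_zero, mul_one] at h1
  simpa [hD, hP] using this

/-- **Continuous dependence of the backward flow on the starting point**: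
`|h s - h₀ s| ≤ |h 0 - h₀ 0| e^{2s/m²}`. [folklore] -/
theorem norm_sub_le_mul_exp (hW : Continuous W) (hm : 0 < m) {h h₀ : ℝ → ℂ}
    (hc : Continuous h) (hc₀ : Continuous h₀)
    (hd : ∀ s ∈ Icc (0 : ℝ) t, HasDerivWithinAt h (-vectorField W ((t : ℝ) - s) (h s))
      (Icc (-1 : ℝ) t) s)
    (hd₀ : ∀ s ∈ Icc (0 : ℝ) t, HasDerivWithinAt h₀ (-vectorField W ((t : ℝ) - s) (h₀ s))
      (Icc (-1 : ℝ) t) s)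
    (him : ∀ s ∈ Icc (0 : ℝ) t, (m : ℝ) ≤ (h s).im) (him₀ : ∀ s ∈ Icc (0 : ℝ) t, (m : ℝ) ≤ (h₀ s).im)
    {s : ℝ} (hs : s ∈ Icc (0 : ℝ) t) :
    ‖h s - h₀ s‖ ≤ ‖h 0 - h₀ 0‖ * Real.exp (2 / m ^ 2 * s) := by
  rw [sub_eq_mul_exp_integral hW hm hc hc₀ hd hd₀ him him₀ hs, norm_mul]
  gcongr
  rw [Complex.norm_exp]
  gcongr
  refine (Complex.re_le_norm _).trans ?_
  have := intervalIntegral.norm_integral_le_of_norm_le_const (a := 0) (b := s)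
    (f := bwdCoeff W t m h h₀) (C := 2 / m ^ 2) fun u _ ↦ norm_bwdCoeff_le hm h h₀ u
  simpa [abs_of_nonneg hs.1, mul_comm] using this

end Linear


/-! ### Holomorphy of `fₜ = gₜ⁻¹` and of `gₜ`; the conformal equivalence -/

/-- **The backward map `fₜ = gₜ⁻¹` is holomorphic on `ℍₒ` with non-vanishing derivative**
(`fₜ'(w₀) = exp ∫₀ᵗ 2/(h(s) - W(t-s))² ds` for the backward trajectory `h` from `w₀`).
Lawler (2005), Ch. 4 §4.1, Thm. 4.6 / eq. (4.7). [cite: Lawler2005, Ch. 4 §4.1] -/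
theorem hasDerivAt_invFunOn_map (hW : Continuous W) (t : ℝ≥0) {w₀ : ℂ} (hw₀ : 0 < w₀.im) :
    ∃ f' : ℂ, f' ≠ 0 ∧ HasDerivAt (Function.invFunOn (map W t) (domain W t)) f' w₀ := by
  set F := Function.invFunOn (map W t) (domain W t) with hFdef
  set m : ℝ≥0 := ⟨w₀.im / 2, by positivity⟩
  have hm : 0 < m := by
    change (0 : ℝ) < w₀.im / 2
    positivity
  have hm' : (0 : ℝ) < m := hm
  have hmw₀ : (m : ℝ) < w₀.im := by
    change w₀.im / 2 < w₀.im
    linarith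
  have hback : ∀ w : ℂ, (m : ℝ) < w.im → ∃ h : ℝ → ℂ, h 0 = w ∧ Continuous h ∧
      (∀ s ∈ Icc (0 : ℝ) t, HasDerivWithinAt h (-vectorField W ((t : ℝ) - s) (h s))
        (Icc (-1 : ℝ) t) s) ∧
      (∀ s ∈ Icc (0 : ℝ) t, w.im ≤ (h s).im) ∧ h t ∈ domain W t ∧ map W t (h t) = w :=
    fun w hw ↦ exists_backward_solution hW t hm hw
  choose H hH0 hHc hHd hHim hHdom hHmap using hback
  have hHim' : ∀ w (hw : (m : ℝ) < w.im), ∀ s ∈ Icc (0 : ℝ) t, (m : ℝ) ≤ (H w hw s).im :=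
    fun w hw s hs ↦ hw.le.trans (hHim w hw s hs)
  have hinv := (bijOn_map hW t).invOn_invFunOn
  have hmapsF : MapsTo F upperHalfPlaneSet (domain W t) := (bijOn_map hW t).surjOn.mapsTo_invFunOn
  -- `F` is given by the backward flow
  have hF : ∀ w (hw : (m : ℝ) < w.im), F w = H w hw t := by
    intro w hw
    have hwH : w ∈ upperHalfPlaneSet := hm'.trans hw
    refine injOn_map hW t (hmapsF hwH) (hHdom w hw) ?_
    rw [hinv.2 hwH, hHmap w hw]
  set h₀ := H w₀ hmw₀ with hh₀
  have hh00 : h₀ 0 = w₀ := hH0 w₀ hmw₀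
  set I₀ : ℂ := ∫ u in (0 : ℝ)..t, bwdCoeff W t m h₀ h₀ u with hI₀
  refine ⟨exp I₀, exp_ne_zero _, ?_⟩
  -- the integrals `∫₀ᵗ A_w` as a function of `w`
  classical
  set G : ℂ → ℂ := fun w ↦ if hw : (m : ℝ) < w.im then
    ∫ u in (0 : ℝ)..t, bwdCoeff W t m (H w hw) h₀ u else I₀ with hG
  set C : ℝ := 2 / m ^ 3 * Real.exp (2 / m ^ 2 * t) * t with hC
  have hGbound : ∀ w, ‖G w - I₀‖ ≤ C * ‖w - w₀‖ := by
    intro w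
    by_cases hw : (m : ℝ) < w.im
    · simp only [hG, dif_pos hw, hI₀]
      rw [← intervalIntegral.integral_sub
        ((continuous_bwdCoeff hW hm (hHc w hw) (hHc w₀ hmw₀)).intervalIntegrable _ _)
        ((continuous_bwdCoeff hW hm (hHc w₀ hmw₀) (hHc w₀ hmw₀)).intervalIntegrable _ _)]
      have hle : ∀ u ∈ Set.uIoc (0 : ℝ) t, ‖bwdCoeff W t m (H w hw) h₀ u - bwdCoeff W t m h₀ h₀ u‖ ≤
          2 / m ^ 3 * Real.exp (2 / m ^ 2 * t) * ‖w - w₀‖ := by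
        intro u hu
        rw [Set.uIoc_of_le t.coe_nonneg] at hu
        have hu' : u ∈ Icc (0 : ℝ) t := ⟨hu.1.le, hu.2⟩
        refine (norm_bwdCoeff_sub_le hm (H w hw) h₀ u).trans ?_
        have hdist := norm_sub_le_mul_exp hW hm (hHc w hw) (hHc w₀ hmw₀) (hHd w hw) (hHd w₀ hmw₀)
          (hHim' w hw) (hHim' w₀ hmw₀) hu'
        simp only [hH0] at hdist
        have hexp : Real.exp (2 / m ^ 2 * u) ≤ Real.exp (2 / m ^ 2 * t) := by
          gcongr; exact hu.2
        calc 2 / (m : ℝ) ^ 3 * ‖H w hw u - h₀ u‖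
            ≤ 2 / (m : ℝ) ^ 3 * (‖w - w₀‖ * Real.exp (2 / m ^ 2 * u)) := by gcongr
          _ ≤ 2 / (m : ℝ) ^ 3 * (‖w - w₀‖ * Real.exp (2 / m ^ 2 * t)) := by gcongr
          _ = 2 / m ^ 3 * Real.exp (2 / m ^ 2 * t) * ‖w - w₀‖ := by ring
      refine (intervalIntegral.norm_integral_le_of_norm_le_const hle).trans ?_
      rw [sub_zero, abs_of_nonneg t.coe_nonneg, hC]
      nlinarith [norm_nonneg (w - w₀), t.coe_nonneg,
        (by positivity : (0 : ℝ) ≤ 2 / m ^ 3 * Real.exp (2 / m ^ 2 * t))]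
    · simp only [hG, dif_neg hw, sub_self, norm_zero]
      positivity
  have hGt : Tendsto G (𝓝 w₀) (𝓝 I₀) := by
    rw [tendsto_iff_norm_sub_tendsto_zero]
    refine squeeze_zero (fun w ↦ norm_nonneg _) hGbound ?_
    have : Tendsto (fun w : ℂ ↦ C * ‖w - w₀‖) (𝓝 w₀) (𝓝 (C * ‖w₀ - w₀‖)) :=
      tendsto_const_nhds.mul (continuous_norm.continuousAt.tendsto.comp
        (tendsto_id.sub tendsto_const_nhds))
    simpa using this
  have hexpG : Tendsto (fun w ↦ exp (G w)) (𝓝[≠] w₀) (𝓝 (exp I₀)) :=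
    ((continuous_exp.continuousAt.tendsto).comp hGt).mono_left nhdsWithin_le_nhds
  rw [hasDerivAt_iff_tendsto_slope]
  refine hexpG.congr' ?_
  have hopen : {w : ℂ | (m : ℝ) < w.im} ∈ 𝓝 w₀ :=
    (isOpen_lt continuous_const Complex.continuous_im).mem_nhds hmw₀
  filter_upwards [mem_nhdsWithin_of_mem_nhds hopen, self_mem_nhdsWithin] with w hw hne
  have hw : (m : ℝ) < w.im := hw
  have hne : w ≠ w₀ := hne
  simp only [hG, dif_pos hw]
  rw [slope_def_field, hF w hw, hF w₀ hmw₀, ← hh₀]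
  have key := sub_eq_mul_exp_integral hW hm (hHc w hw) (hHc w₀ hmw₀) (hHd w hw) (hHd w₀ hmw₀)
    (hHim' w hw) (hHim' w₀ hmw₀) (s := t) ⟨t.coe_nonneg, le_rfl⟩
  simp only [hH0] at key
  rw [key, ← hh₀, mul_div_cancel_left₀ _ (sub_ne_zero.2 hne)]

/-- **`fₜ = gₜ⁻¹` is holomorphic on `ℍₒ`.** [cite: Lawler2005, Ch. 4 §4.1] -/
theorem differentiableOn_invFunOn_map (hW : Continuous W) (t : ℝ≥0) :
    DifferentiableOn ℂ (Function.invFunOn (map W t) (domain W t)) upperHalfPlaneSet :=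
  fun _ hw ↦ (hasDerivAt_invFunOn_map hW t hw).choose_spec.2.differentiableAt.differentiableWithinAt

/-- The backward map is a bijection `ℍₒ → Hₜ`. [folklore] -/
theorem bijOn_invFunOn_map (hW : Continuous W) (t : ℝ≥0) :
    BijOn (Function.invFunOn (map W t) (domain W t)) upperHalfPlaneSet (domain W t) :=
  (bijOn_map hW t).symm (bijOn_map hW t).invOn_invFunOn.symm

/-- **The Loewner map `gₜ` is holomorphic on `Hₜ`** (as the inverse of the holomorphic
injection `fₜ` with non-vanishing derivative; `Complex.differentiableOn_invFunOn_image`).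
Lawler (2005), Ch. 4 §4.1, Thm. 4.6. [cite: Lawler2005, Ch. 4 §4.1] -/
theorem differentiableOn_map (hW : Continuous W) (t : ℝ≥0) :
    DifferentiableOn ℂ (map W t) (domain W t) := by
  set F := Function.invFunOn (map W t) (domain W t) with hFdef
  have hbij := bijOn_invFunOn_map hW t
  have hderiv : ∀ w ∈ upperHalfPlaneSet, deriv F w ≠ 0 := fun w hw ↦ by
    obtain ⟨f', hf', hd⟩ := hasDerivAt_invFunOn_map hW t (w₀ := w) hw
    rwa [hd.deriv]
  have h := Complex.differentiableOn_invFunOn_image isOpen_upperHalfPlaneSet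
    (differentiableOn_invFunOn_map hW t) hbij.injOn hderiv
  rw [hbij.image_eq] at h
  refine h.congr fun z hz ↦ ?_
  -- `invFunOn F ℍₒ = map W t` on `Hₜ`
  have hz' : z ∈ F '' upperHalfPlaneSet := by rw [hbij.image_eq]; exact hz
  have h1 : F (Function.invFunOn F upperHalfPlaneSet z) = z := Function.invFunOn_eq hz'
  have h2 : Function.invFunOn F upperHalfPlaneSet z ∈ upperHalfPlaneSet := Function.invFunOn_mem hz'
  have h3 : F (map W t z) = z := (bijOn_map hW t).invOn_invFunOn.1 hz
  exact (hbij.injOn h2 (mapsTo_map hW t hz) (h1.trans h3.symm)).symm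

/-- **`Literature.Probability.RandomPlanarGeometry.Loewner.exists_conformalEquiv_map` holds**: for a continuous driving function the
Loewner map `gₜ` is a conformal equivalence of `Hₜ = ℍₒ ∖ Kₜ` onto `ℍₒ`. Lawler (2005),
Ch. 4 §4.1, Thm. 4.6. [cite: Lawler2005, Ch. 4 §4.1 Thm. 4.6] -/
theorem exists_conformalEquiv_map_holds : exists_conformalEquiv_map (W := W) := fun hW t ↦
  ⟨ConformalEquiv.ofBijOn (map W t) (differentiableOn_map hW t) (bijOn_map hW t)
    (differentiableOn_invFunOn_map hW t), fun _ _ ↦ rfl⟩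

end Loewner

end Literature.Probability.RandomPlanarGeometry
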